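import Literature.Analysis.FluidPDE.PlanarChainCutoffs
import HarnessLib

/-!
# The move of a chain: all clauses of an explicit generator move on a time slot

Topic `Literature/Analysis/FluidPDE`. Packaging file of the explicit pullback calculus for the
planar transport equation. Given a well-formed chain of cut-offs (`PlanarChainCutoffs.lean`:
boxes, moving junction steps, the order and disjointness conditions), element scalars and
stream functions `Θ_k, H_k` with their ANALYTIC facts (smooth; each `Θ_k` transported everywhere
by `∇⊥H_k`; bounded by `M`; supported, inside its tube box, in a closed band), open agreement
regions on which consecutive elements coincide, and the per-element cover condition, this file
defines the fields of the chain move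

  `Θ = Σ χ_k Θ_k`,  `Ĥ = H₀ + Σ χ_k (H_k - H₀)`,  `V = ∇⊥ Ĥ`

(`ChainData.moveScalar / moveStream / moveVelocity`) and proves every clause that a generator
move (`QuasiSelfSimilar.IsGeneratorMove`) asks of them on the slot `S × Q`: smoothness
(`contDiff_uncurry_move…`), incompressibility everywhere (`divergence_moveVelocity`), transport
on `S × Q` (`transport_move`), the bound `|Θ| ≤ M` on `S × Q` (`abs_moveScalar_le`), vanishing of
`V` off the tube boxes and of `Θ` off the tubes (`moveVelocity_eq_zero_off_tubeBoxes`,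
`moveScalar_eq_zero_off_tubes`) — the boundary strips — and the identification of `(Θ, V)` with
`(Θ_k, ∇⊥H_k)` at core points of an element (`move_eq_of_core`) — the gate windows. What is left
to a design is data: the chain, the element data, and finitely many inequalities.

Folklore; no named facts. Infrastructure towards a discharge of `acm_compatible_blocks`
(`QuasiSelfSimilarCompatibleBlocks.lean`).

## References

* G. Alberti, G. Crippa, A. L. Mazzucato, *Exponential self-similar mixing by incompressible
  flows*, J. Amer. Math. Soc. 32 (2019), 445–490, §§7–8 (arXiv:1605.02090).
-/

noncomputable section

open Function Set Filter
open scoped Topology ContDiff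

namespace Literature.Analysis.FluidPDE

namespace PlanarKinematics

/-- The plane `ℝ²` as a Euclidean space. [folklore] -/
local notation "E²" => EuclideanSpace ℝ (Fin 2)

namespace ChainData

variable (C : ChainData) (H₀ : ℝ) (Θ H : ℕ → ℝ → E² → ℝ)

/-! ## The fields of a chain move -/

/-- **Scalar of the chain move** `Θ = Σ_k χ_k Θ_k`. [folklore] -/
def moveScalar : ℝ → E² → ℝ := assembledScalar C.K C.chi Θ

/-- **Stream function of the chain move** `Ĥ = H₀ + Σ_k χ_k (H_k - H₀)`. [folklore] -/
def moveStream : ℝ → E² → ℝ := assembledStream C.K H₀ C.chi H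

/-- **Velocity of the chain move** `V = ∇⊥ Ĥ`. [folklore] -/
def moveVelocity : ℝ → E² → E² := assembledVelocity C.K H₀ C.chi H

/-- Unfolding the scalar. [folklore] -/
theorem moveScalar_def : C.moveScalar Θ = assembledScalar C.K C.chi Θ := rfl

/-- Unfolding the stream function. [folklore] -/
theorem moveStream_def : C.moveStream H₀ H = assembledStream C.K H₀ C.chi H := rfl

/-- Unfolding the velocity. [folklore] -/
theorem moveVelocity_def : C.moveVelocity H₀ H = assembledVelocity C.K H₀ C.chi H := rfl

/-- The velocity is the perpendicular gradient of the stream function. [folklore] -/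
theorem moveVelocity_apply (t : ℝ) (z : E²) : C.moveVelocity H₀ H t z = perpGrad (C.moveStream H₀ H t) z := rfl

/-! ## Analytic facts of the elements -/

/-- **Element facts**: what the element files provide for each element of a chain — joint
smoothness of scalar and stream function, transport of the scalar by the perpendicular gradient
of the stream function at every point, a uniform bound, and a closed band containing, within the
tube box, the support of the scalar. [folklore] -/
structure ElemFacts (M : ℝ) (Band : ℕ → Set (ℝ × E²)) : Prop where
  /-- `Θ_k ∈ C^∞(ℝ × ℝ²)` -/
  smooth_scalar : ∀ k < C.K, ContDiff ℝ ∞ (uncurry (Θ k))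
  /-- `H_k ∈ C^∞(ℝ × ℝ²)` -/
  smooth_stream : ∀ k < C.K, ContDiff ℝ ∞ (uncurry (H k))
  /-- `Θ_k` is transported by `∇⊥H_k` everywhere -/
  transport : ∀ k < C.K, ∀ (t : ℝ) (z : E²),
    deriv (fun s => Θ k s z) t + fderiv ℝ (Θ k t) z (perpGrad (H k t) z) = 0
  /-- `|Θ_k| ≤ M` -/
  abs_le : ∀ k < C.K, ∀ (t : ℝ) (z : E²), |Θ k t z| ≤ M
  /-- the bound is nonnegative -/
  M_nonneg : 0 ≤ M
  /-- bands are closed -/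
  isClosed_band : ∀ k < C.K, IsClosed (Band k)
  /-- within the tube box, `Θ_k ≠ 0` only on the band -/
  band : ∀ k < C.K, ∀ p : ℝ × E², p ∈ C.tubeBox k → Θ k p.1 p.2 ≠ 0 → p ∈ Band k

/-- **Junction agreement**: open regions on which consecutive elements coincide. [folklore] -/
structure Agreement (Agree : ℕ → Set (ℝ × E²)) : Prop where
  /-- agreement regions are open -/
  isOpen : ∀ k, k + 1 < C.K → IsOpen (Agree k)
  /-- scalars agree -/
  scalar : ∀ k, k + 1 < C.K → ∀ p ∈ Agree k, Θ (k + 1) p.1 p.2 = Θ k p.1 p.2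
  /-- stream functions agree -/
  stream : ∀ k, k + 1 < C.K → ∀ p ∈ Agree k, H (k + 1) p.1 p.2 = H k p.1 p.2

variable {C H₀ Θ H}

/-! ## Smoothness and incompressibility -/

/-- **The scalar of a chain move is smooth.** [folklore] -/
theorem contDiff_uncurry_moveScalar (h : C.WF) {M : ℝ} {Band : ℕ → Set (ℝ × E²)}
    (hE : C.ElemFacts Θ H M Band) : ContDiff ℝ ∞ (uncurry (C.moveScalar Θ)) :=
  contDiff_uncurry_assembledScalar C.K C.chi Θ (fun k _ => h.contDiff_uncurry_chi k) hE.smooth_scalar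

/-- **The stream function of a chain move is smooth.** [folklore] -/
theorem contDiff_uncurry_moveStream (h : C.WF) {M : ℝ} {Band : ℕ → Set (ℝ × E²)}
    (hE : C.ElemFacts Θ H M Band) : ContDiff ℝ ∞ (uncurry (C.moveStream H₀ H)) :=
  contDiff_uncurry_assembledStream C.K H₀ C.chi H (fun k _ => h.contDiff_uncurry_chi k) hE.smooth_stream

/-- **The velocity of a chain move is smooth.** [folklore] -/
theorem contDiff_uncurry_moveVelocity (h : C.WF) {M : ℝ} {Band : ℕ → Set (ℝ × E²)}
    (hE : C.ElemFacts Θ H M Band) : ContDiff ℝ ∞ (uncurry (C.moveVelocity H₀ H)) :=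
  contDiff_uncurry_assembledVelocity C.K H₀ C.chi H (fun k _ => h.contDiff_uncurry_chi k) hE.smooth_stream

/-- **The velocity of a chain move is divergence free everywhere.** [folklore] -/
theorem divergence_moveVelocity (h : C.WF) {M : ℝ} {Band : ℕ → Set (ℝ × E²)}
    (hE : C.ElemFacts Θ H M Band) (t : ℝ) (z : E²) :
    ∑ j, fderiv ℝ (C.moveVelocity H₀ H t) z (EuclideanSpace.single j 1) j = 0 :=
  divergence_assembledVelocity C.K H₀ C.chi H (fun k _ => h.contDiff_uncurry_chi k) hE.smooth_stream t z

/-! ## Transport and the bound on a slot -/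

/-- **Transport of a chain move on `S × Q`**: a well-formed chain, element facts, junction
agreement and the per-element cover of the tubes over `S × Q` give `∂ₜΘ + D_zΘ[V] = 0` at every
point of `S × Q`. [folklore] -/
theorem transport_move (h : C.WF) {M : ℝ} {Band Agree : ℕ → Set (ℝ × E²)} {S : Set ℝ} {Q : Set E²}
    (hE : C.ElemFacts Θ H M Band) (hA : C.Agreement Θ H Agree)
    (hcover : ∀ t ∈ S, ∀ z ∈ Q, ∀ k < C.K, (t, z) ∈ C.tubeBox k ∩ Band k →
      (t, z) ∈ C.core k ∨ (0 < k ∧ (t, z) ∈ C.juncCut (k - 1) ∩ Agree (k - 1)) ∨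
        (k + 1 < C.K ∧ (t, z) ∈ C.juncCut k ∩ Agree k)) :
    ∀ t ∈ S, ∀ z ∈ Q, deriv (fun s => C.moveScalar Θ s z) t +
      fderiv ℝ (C.moveScalar Θ t) z (C.moveVelocity H₀ H t z) = 0 :=
  transport_assembled_of_regions
    (h.isRegionData hA.isOpen hA.scalar hA.stream hE.isClosed_band hE.band hcover)
    fun k hk t _ z _ => hE.transport k hk t z

/-- **The bound of a chain move on `S × Q`**: `|Θ| ≤ M`. [folklore] -/
theorem abs_moveScalar_le (h : C.WF) {M : ℝ} {Band Agree : ℕ → Set (ℝ × E²)} {S : Set ℝ} {Q : Set E²}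
    (hE : C.ElemFacts Θ H M Band) (hA : C.Agreement Θ H Agree)
    (hcover : ∀ t ∈ S, ∀ z ∈ Q, ∀ k < C.K, (t, z) ∈ C.tubeBox k ∩ Band k →
      (t, z) ∈ C.core k ∨ (0 < k ∧ (t, z) ∈ C.juncCut (k - 1) ∩ Agree (k - 1)) ∨
        (k + 1 < C.K ∧ (t, z) ∈ C.juncCut k ∩ Agree k)) :
    ∀ t ∈ S, ∀ z ∈ Q, |C.moveScalar Θ t z| ≤ M :=
  abs_assembledScalar_le_of_regions
    (h.isRegionData hA.isOpen hA.scalar hA.stream hE.isClosed_band hE.band hcover) hE.M_nonneg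
    fun k hk t _ z _ => hE.abs_le k hk t z

/-! ## Vanishing off the tubes -/

/-- **The velocity of a chain move vanishes off the tube boxes**: at a point outside every tube
box the stream function is locally the background constant. (The boundary strips of the square
away from the gate windows lie outside all tube boxes.) [folklore] -/
theorem moveVelocity_eq_zero_off_tubeBoxes (h : C.WF) {t : ℝ} {z : E²}
    (hz : ∀ k < C.K, (t, z) ∉ C.tubeBox k) : C.moveVelocity H₀ H t z = 0 :=
  assembledVelocity_eq_zero_off_streamTubes (TubeH := C.tubeBox) (fun k hk => h.isClosed_tubeBox hk)
    (fun k hk p hne => h.mem_tubeBox_of_chi_ne_zero hk fun e => hne (by rw [e, zero_mul])) hz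

/-- **The scalar of a chain move vanishes off the tubes** (tube box ∩ band). [folklore] -/
theorem moveScalar_eq_zero_off_tubes (h : C.WF) {M : ℝ} {Band : ℕ → Set (ℝ × E²)} (hE : C.ElemFacts Θ H M Band)
    {t : ℝ} {z : E²} (hz : ∀ k < C.K, (t, z) ∉ C.tubeBox k ∩ Band k) : C.moveScalar Θ t z = 0 := by
  refine assembledScalar_eq_zero_off_tubes (Tube := fun k => C.tubeBox k ∩ Band k) (fun k hk p hne => ?_) hz
  have hχ : C.chi k p.1 p.2 ≠ 0 := fun e => hne (by rw [e, zero_mul])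
  have hΘ : Θ k p.1 p.2 ≠ 0 := fun e => hne (by rw [e, mul_zero])
  have hmem := h.mem_tubeBox_of_chi_ne_zero hk hχ
  exact ⟨hmem, hE.band k hk p hmem hΘ⟩

/-- **Both fields vanish off the tube boxes.** [folklore] -/
theorem move_eq_zero_off_tubeBoxes (h : C.WF) {M : ℝ} {Band : ℕ → Set (ℝ × E²)} (hE : C.ElemFacts Θ H M Band)
    {t : ℝ} {z : E²} (hz : ∀ k < C.K, (t, z) ∉ C.tubeBox k) :
    C.moveVelocity H₀ H t z = 0 ∧ C.moveScalar Θ t z = 0 :=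
  ⟨moveVelocity_eq_zero_off_tubeBoxes h hz, moveScalar_eq_zero_off_tubes h hE fun k hk hmem => hz k hk hmem.1⟩

/-! ## Identification on cores -/

/-- **On the core of an element the chain move is that element**: at a point of `core k` the
scalar is `Θ_k(t,z)` and the velocity is `∇⊥H_k(t,·)(z)`. (At the gate windows the stub element is
the prescribed gate field.) [folklore] -/
theorem move_eq_of_core (h : C.WF) {k : ℕ} (hk : k < C.K) {t : ℝ} {z : E²} (hp : (t, z) ∈ C.core k) :
    C.moveScalar Θ t z = Θ k t z ∧ C.moveVelocity H₀ H t z = perpGrad (H k t) z := by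
  have hopen := h.isOpen_core hk
  have h1 : ∀ᶠ p in 𝓝 (t, z), C.chi k p.1 p.2 = 1 :=
    eventually_of_mem_open (P := fun s w => C.chi k s w = 1) hopen hp fun p hp' =>
      (h.chi_core hk hp'.1.1 (C.sigmaIn_eq_one_of_mem hk hp'.1.2) (C.sigmaOut_eq_zero_of_mem hp'.2)).1
  have h0 : ∀ j < C.K, j ≠ k → ∀ᶠ p in 𝓝 (t, z), C.chi j p.1 p.2 = 0 := fun j hj hjk =>
    eventually_of_mem_open (P := fun s w => C.chi j s w = 0) hopen hp fun p hp' =>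
      (h.chi_core hk hp'.1.1 (C.sigmaIn_eq_one_of_mem hk hp'.1.2) (C.sigmaOut_eq_zero_of_mem hp'.2)).2 j hj hjk
  exact assembled_eq_prescribed_of_core (Θg := Θ k) (Hg := H k) hk h1 h0 (Eventually.of_forall fun _ => rfl)
    (Eventually.of_forall fun _ => rfl)

/-- **Agreement with a prescribed pair on a core**: if on `core k` the element `k` is a prescribed
pair `(Θg, Hg)` (pointwise on the open core), then at every point of `core k` the chain move has
scalar `Θg` and velocity `∇⊥Hg`. [folklore] -/
theorem move_eq_prescribed_of_core (h : C.WF) {k : ℕ} (hk : k < C.K) {Θg Hg : ℝ → E² → ℝ}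
    (hΘ : ∀ p ∈ C.core k, Θ k p.1 p.2 = Θg p.1 p.2) (hH : ∀ p ∈ C.core k, H k p.1 p.2 = Hg p.1 p.2)
    {t : ℝ} {z : E²} (hp : (t, z) ∈ C.core k) :
    C.moveScalar Θ t z = Θg t z ∧ C.moveVelocity H₀ H t z = perpGrad (Hg t) z := by
  have hopen := h.isOpen_core hk
  have h1 : ∀ᶠ p in 𝓝 (t, z), C.chi k p.1 p.2 = 1 :=
    eventually_of_mem_open (P := fun s w => C.chi k s w = 1) hopen hp fun p hp' =>
      (h.chi_core hk hp'.1.1 (C.sigmaIn_eq_one_of_mem hk hp'.1.2) (C.sigmaOut_eq_zero_of_mem hp'.2)).1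
  have h0 : ∀ j < C.K, j ≠ k → ∀ᶠ p in 𝓝 (t, z), C.chi j p.1 p.2 = 0 := fun j hj hjk =>
    eventually_of_mem_open (P := fun s w => C.chi j s w = 0) hopen hp fun p hp' =>
      (h.chi_core hk hp'.1.1 (C.sigmaIn_eq_one_of_mem hk hp'.1.2) (C.sigmaOut_eq_zero_of_mem hp'.2)).2 j hj hjk
  exact assembled_eq_prescribed_of_core hk h1 h0
    (eventually_of_mem_open (P := fun s w => Θ k s w = Θg s w) hopen hp hΘ)
    (eventually_of_mem_open (P := fun s w => H k s w = Hg s w) hopen hp hH)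

end ChainData

end PlanarKinematics

end Literature.Analysis.FluidPDE
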